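/-
Copyright (c) 2026 the pub-hodgecm-mathlib formalisation cell (harness21).  Prover seat hodgecm-mathlib-F0P3a-p07 (g14): «S3-ram» seeding wave (LEAD F0P3a-plan (g12∕g13);
owner F0P3a-p06 (g15)), (T2) G-side organ (Cnt2′), sub-organ (z1-b) «AXIS ⟷ W-SIDE TRANSPORT ALONG THE ENDOSCOPIC BLOCK FRAME»; 2026-09-02.
-/
import Literature.NumberTheory.Rogawski1990.EndoscopicEmbedding                       -- ★ `endoGL`, `coe_endoGL_eq`
import Literature.NumberTheory.Automorphic.UnitaryLatticeTreeTypeTwoGram                -- ★ `isIntMatrix_mul`, `isIntMatrix_transpose_map`, `v_det_eq_one_of_isIntMatrix_inv`, `latt_mul_eq_of_isIntMatrix`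
import Literature.NumberTheory.Automorphic.UnitaryLatticeTreeLevelShift                 -- ★ `map_sub_one_latt_le_scaleLattice_iff`; brings ★ `isIntMatrix_nonsing_inv_of_v_det_eq_one`
import Literature.NumberTheory.Automorphic.UnitaryLatticeTreeStabilizer                 -- ★ `mapGL_latt_eq_latt_iff`
import Literature.NumberTheory.Automorphic.UnitaryLatticeTreeFixedChildTokensRamified   -- ★ `map_toLin'_latt_le_scaleLattice_iff`
import HarnessLib

/-!
# Axis lattices of the endoscopic block frame: fixedness, level and self-duality of `latt (ι(g₂, 1))` under `ι(γ₂, u)` are those of `latt g₂` under `γ₂`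
# (Bruhat–Tits 1972 §10; Kottwitz 1986 §3; Rogawski 1990 §4.8)

Topic `NumberTheory/Automorphic`; namespace `Literature.NumberTheory.Automorphic.UnitaryLatticeTree`.  THEOREMS ONLY (no definition, no instance, no notation, no named fact,
no `sorry`); kernel lane `--supports stmt-HodgeConjecture-24833`; datum-free (`K` with `Valued K ℤᵐ⁰`).  Cell `pub/hodgecm-mathlib`, crux H413; road «S3-ram» (count-neutral),
(T2) G-side organ (Cnt2′) of F0P3a-p07 (g14)'s skeleton, sub-organ **(z1-b)** of architect A-p12 (g24)'s tube decomposition (bus 2026-09-02T01:30Z): the AXIS part of the fixed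
self-dual lattices of the frame literal `t₀` — whose one-place matrix is the endoscopic block `ι(g_w, u_w) = !![g₀₀, 0, g₀₁; 0, u, 0; g₁₀, 0, g₁₁]` (★ `endoGL`, ★ p847566
`exists_isLocalNormPair_coe_eq_of_frame`) — is read on the `U(W)`-side.

THE MATHEMATICS.  `V = K³ = W ⊕ Ke₁`, `W = ⟨e₀, e₂⟩`; `ι(g₂, g₁) = endoGL (g₂, g₁)` acts by `g₂` on `W` and by `g₁` on `Ke₁`, and `ι` is a group homomorphism.  For the AXIS lattice
`M = latt ι(g₂, 1) = g₂·𝒪² ⊕ 𝒪e₁` and the block element `Γ = ι(γ₂, u)` every lattice token of the (a2)∕(Cnt2′) currency splits along the blocks, because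
`ι(g₂,1)⁻¹ · Γ · ι(g₂,1) = ι(g₂⁻¹γ₂g₂, u)` and an `ι`-shaped matrix is integral ∕ `≡ 0 (mod c)` iff its two blocks are:
* §1 block bookkeeping: integrality and `c`-bounds of `ι`-shaped matrices, `ι(a,b) − 1`, squares;
* §2 **FIXEDNESS** `Γ·M = M ⟺ γ₂·(g₂𝒪²) = g₂𝒪² ∧ |u| = 1` (★ stabiliser test `mapGL_latt_eq_latt_iff` on both sides);
* §3 **LEVEL** `(Γ − 1)M ⊆ cM ⟺ (γ₂ − 1)(g₂𝒪²) ⊆ c·g₂𝒪² ∧ |u − 1| ≤ |c|` and the same for `(Γ − 1)²` (★ `map_sub_one_latt_le_scaleLattice_iff`, ★ `map_toLin'_latt_le_scaleLattice_iff`) —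
  the (a2) labels `LEV(ϖ)`, `LEV(ϖ²)`, `LEV₂(ϖ³)` of an axis vertex are those of the `W`-block once `u` is 2-deep;
* §4 **VERTEX TYPE IS BASIS-INDEPENDENT** (`isVertexLattice_latt_iff_of_v`): `IsVertexLattice σ ϖ H d (latt g)` iff the Gram matrix of THIS `g` is integral with `ϖ·G⁻¹` integral and
  `|det G| = |ϖ|^d` (`|σ·| = |·|`);
* §5 **SELF-DUALITY** for a block form `H = ι-shape(H₂, h)`, `|h| = 1`: `latt ι(g₂,1)` is self-dual for `H` iff `latt g₂` is self-dual for `H₂` (Gram matrix `ι-shape((σg₂)ᵀH₂g₂, h)`).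
The companion (z1-a) «every self-dual lattice containing `e₁` is `latt ι(g₂, 1)`» is a separate file.  HONEST LABEL: HC_CM is proved only modulo the 2 remaining named inputs
(hLiu418 24832, h413 24833) until rung 0 closes; elementary lattice algebra, no books consequence.

## References
* [BruhatTits1972] F. Bruhat, J. Tits, *Groupes réductifs sur un corps local I*, Publ. Math. IHÉS 41 (1972), §10.
* [Kottwitz1986] R. E. Kottwitz, *Base change for unit elements of Hecke algebras*, Compositio Math. 60 (1986), §3.
* [Rogawski1990] J. D. Rogawski, *Automorphic Representations of Unitary Groups in Three Variables*, Ann. of Math. Stud. 123 (1990), §4.8 Case (a) p. 53, §4.9 p. 55.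
* [Serre1980Trees] J.-P. Serre, *Trees* (1980), Ch. II §1.1.
-/

set_option autoImplicit false

noncomputable section

open scoped Valued WithZero Matrix MatrixGroups

namespace Literature.NumberTheory.Automorphic.UnitaryLatticeTree

open Literature.NumberTheory.Automorphic Literature.NumberTheory.Automorphic.HermitianLattice Literature.NumberTheory.Rogawski1990

variable {K : Type*} [Field K] [Valued K ℤᵐ⁰]

/-! ## §1 Block bookkeeping for `ι`-shaped matrices -/

/-- An `ι`-shaped matrix `!![a₀₀, 0, a₀₁; 0, b, 0; a₁₀, 0, a₁₁]` has all entries of valuation `≤ r` iff its two blocks do. [cite: Rogawski1990, §4.8 Case (a) p. 53] -/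
theorem forall_v_endoShape_le_iff (a : Matrix (Fin 2) (Fin 2) K) (b : K) (r : ℤᵐ⁰) :
    (∀ i j, Valued.v ((!![a 0 0, 0, a 0 1; 0, b, 0; a 1 0, 0, a 1 1] : Matrix (Fin 3) (Fin 3) K) i j) ≤ r) ↔
      (∀ i j, Valued.v (a i j) ≤ r) ∧ Valued.v b ≤ r := by
  constructor
  · intro h
    refine ⟨fun i j => ?_, by simpa using h 1 1⟩
    fin_cases i <;> fin_cases j
    · simpa using h 0 0
    · simpa using h 0 2
    · simpa using h 2 0
    · simpa using h 2 2
  · rintro ⟨ha, hb⟩ i j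
    fin_cases i <;> fin_cases j <;> simp [ha _ _, hb]

omit [Valued K ℤᵐ⁰] in
/-- The matrix of `ι(a, b)` (★ `coe_endoGL_eq`, restated with the `1 × 1` entry named). [cite: Rogawski1990, §4.8 Case (a) p. 53] -/
theorem coe_endoGL_eq_endoShape (a : GL (Fin 2) K) (b : GL (Fin 1) K) :
    ((endoGL (a, b) : GL (Fin 3) K) : Matrix (Fin 3) (Fin 3) K) =
      !![(a : Matrix (Fin 2) (Fin 2) K) 0 0, 0, (a : Matrix (Fin 2) (Fin 2) K) 0 1; 0, (b : Matrix (Fin 1) (Fin 1) K) 0 0, 0;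
        (a : Matrix (Fin 2) (Fin 2) K) 1 0, 0, (a : Matrix (Fin 2) (Fin 2) K) 1 1] :=
  coe_endoGL_eq (a, b)

omit [Valued K ℤᵐ⁰] in
/-- `ι(a, b) − 1` is `ι`-shaped with blocks `a − 1`, `b − 1`. [cite: Rogawski1990, §4.8 Case (a) p. 53] -/
theorem coe_endoGL_sub_one_eq_endoShape (a : GL (Fin 2) K) (b : GL (Fin 1) K) :
    ((endoGL (a, b) : GL (Fin 3) K) : Matrix (Fin 3) (Fin 3) K) - 1 =
      !![((a : Matrix (Fin 2) (Fin 2) K) - 1) 0 0, 0, ((a : Matrix (Fin 2) (Fin 2) K) - 1) 0 1; 0, (b : Matrix (Fin 1) (Fin 1) K) 0 0 - 1, 0;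
        ((a : Matrix (Fin 2) (Fin 2) K) - 1) 1 0, 0, ((a : Matrix (Fin 2) (Fin 2) K) - 1) 1 1] := by
  rw [coe_endoGL_eq_endoShape]
  ext i j
  fin_cases i <;> fin_cases j <;> simp

omit [Valued K ℤᵐ⁰] in
/-- The square of an `ι`-shaped matrix is `ι`-shaped with squared blocks. [cite: Rogawski1990, §4.8 Case (a) p. 53] -/
theorem endoShape_mul_endoShape (a a' : Matrix (Fin 2) (Fin 2) K) (b b' : K) :
    (!![a 0 0, 0, a 0 1; 0, b, 0; a 1 0, 0, a 1 1] : Matrix (Fin 3) (Fin 3) K) * !![a' 0 0, 0, a' 0 1; 0, b', 0; a' 1 0, 0, a' 1 1] =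
      !![(a * a') 0 0, 0, (a * a') 0 1; 0, b * b', 0; (a * a') 1 0, 0, (a * a') 1 1] := by
  ext i j
  fin_cases i <;> fin_cases j <;> simp [Matrix.mul_apply, Fin.sum_univ_three, Fin.sum_univ_two]

/-- `IsIntMatrix ι(a, b) ⟺ IsIntMatrix a ∧ |b| ≤ 1`. [cite: Rogawski1990, §4.8 Case (a) p. 53] -/
theorem isIntMatrix_coe_endoGL_iff (a : GL (Fin 2) K) (b : GL (Fin 1) K) :
    IsIntMatrix ((endoGL (a, b) : GL (Fin 3) K) : Matrix (Fin 3) (Fin 3) K) ↔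
      IsIntMatrix (a : Matrix (Fin 2) (Fin 2) K) ∧ Valued.v ((b : Matrix (Fin 1) (Fin 1) K) 0 0) ≤ 1 := by
  rw [IsIntMatrix, coe_endoGL_eq_endoShape, forall_v_endoShape_le_iff]; rfl

omit [Valued K ℤᵐ⁰] in
/-- Conjugating a block element by an axis frame: `ι(g₂,1)⁻¹ · ι(γ₂,u) · ι(g₂,1) = ι(g₂⁻¹γ₂g₂, u)`. [cite: Rogawski1990, §4.8 Case (a) p. 53] -/
theorem endoGL_inv_mul_endoGL_mul_endoGL (g₂ γ₂ : GL (Fin 2) K) (u : GL (Fin 1) K) :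
    (endoGL (g₂, (1 : GL (Fin 1) K)))⁻¹ * endoGL (γ₂, u) * endoGL (g₂, (1 : GL (Fin 1) K)) = endoGL (g₂⁻¹ * γ₂ * g₂, u) := by
  rw [← map_inv, ← map_mul, ← map_mul, Prod.inv_mk, inv_one, Prod.mk_mul_mk, Prod.mk_mul_mk, one_mul, mul_one]

/-- A `1 × 1` invertible matrix is in `GL₁(𝒪)` (it and its inverse integral) iff its entry is a unit of `𝒪`. [cite: Serre1980Trees, Ch. II §1.1] -/
theorem v_le_one_and_v_inv_le_one_iff (b : GL (Fin 1) K) :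
    (Valued.v ((b : Matrix (Fin 1) (Fin 1) K) 0 0) ≤ 1 ∧ Valued.v (((b⁻¹ : GL (Fin 1) K) : Matrix (Fin 1) (Fin 1) K) 0 0) ≤ 1) ↔
      Valued.v ((b : Matrix (Fin 1) (Fin 1) K) 0 0) = 1 := by
  have hmul : (b : Matrix (Fin 1) (Fin 1) K) 0 0 * ((b⁻¹ : GL (Fin 1) K) : Matrix (Fin 1) (Fin 1) K) 0 0 = 1 := by
    have h := congrArg (fun M : Matrix (Fin 1) (Fin 1) K => M 0 0) (show (b : Matrix (Fin 1) (Fin 1) K) * ((b⁻¹ : GL (Fin 1) K) : Matrix (Fin 1) (Fin 1) K) = 1 by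
      rw [← Units.val_mul, mul_inv_cancel, Units.val_one])
    simpa [Matrix.mul_apply] using h
  have hv : Valued.v ((b : Matrix (Fin 1) (Fin 1) K) 0 0) * Valued.v (((b⁻¹ : GL (Fin 1) K) : Matrix (Fin 1) (Fin 1) K) 0 0) = 1 := by
    rw [← map_mul, hmul, map_one]
  constructor
  · rintro ⟨h1, h2⟩
    refine le_antisymm h1 ?_
    calc (1 : ℤᵐ⁰) = _ := hv.symm
      _ ≤ Valued.v ((b : Matrix (Fin 1) (Fin 1) K) 0 0) * 1 := mul_le_mul' le_rfl h2
      _ = _ := mul_one _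
  · intro h
    refine ⟨h.le, ?_⟩
    have h2 : Valued.v (((b⁻¹ : GL (Fin 1) K) : Matrix (Fin 1) (Fin 1) K) 0 0) = 1 := by rw [h, one_mul] at hv; exact hv
    exact h2.le

/-! ## §2 Fixedness transport -/

/-- **FIXEDNESS OF AN AXIS LATTICE IS FIXEDNESS OF ITS W-BLOCK**: `ι(γ₂, u) · latt ι(g₂, 1) = latt ι(g₂, 1) ⟺ γ₂ · latt g₂ = latt g₂ ∧ |u| = 1`.
[cite: BruhatTits1972, §10] [cite: Kottwitz1986, §3] [cite: Serre1980Trees, Ch. II §1.1] -/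
theorem mapGL_endoGL_latt_endoGL_eq_iff (g₂ γ₂ : GL (Fin 2) K) (u : GL (Fin 1) K) :
    mapGL (endoGL (γ₂, u)) (latt ((endoGL (g₂, (1 : GL (Fin 1) K)) : GL (Fin 3) K) : Matrix (Fin 3) (Fin 3) K)) =
        latt ((endoGL (g₂, (1 : GL (Fin 1) K)) : GL (Fin 3) K) : Matrix (Fin 3) (Fin 3) K) ↔
      mapGL γ₂ (latt (g₂ : Matrix (Fin 2) (Fin 2) K)) = latt (g₂ : Matrix (Fin 2) (Fin 2) K) ∧ Valued.v ((u : Matrix (Fin 1) (Fin 1) K) 0 0) = 1 := by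
  rw [mapGL_latt_eq_latt_iff, mapGL_latt_eq_latt_iff, endoGL_inv_mul_endoGL_mul_endoGL,
    show (endoGL (g₂, (1 : GL (Fin 1) K)))⁻¹ * (endoGL (γ₂, u))⁻¹ * endoGL (g₂, (1 : GL (Fin 1) K)) = endoGL (g₂⁻¹ * γ₂⁻¹ * g₂, u⁻¹) by
      rw [← map_inv, ← map_inv, ← map_mul, ← map_mul, Prod.inv_mk, Prod.inv_mk, inv_one, Prod.mk_mul_mk, Prod.mk_mul_mk, one_mul, mul_one],
    isIntMatrix_coe_endoGL_iff, isIntMatrix_coe_endoGL_iff, ← v_le_one_and_v_inv_le_one_iff]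
  tauto

/-! ## §3 Level transport -/

/-- **THE LEVEL OF A BLOCK ELEMENT AT AN AXIS LATTICE**: for `c ≠ 0`, `(ι(γ₂,u) − 1)·latt ι(g₂,1) ⊆ c·latt ι(g₂,1) ⟺ (γ₂ − 1)·latt g₂ ⊆ c·latt g₂ ∧ |u − 1| ≤ |c|`
(the (a2) tokens `LEV(ϖ)`, `LEV(ϖ²)` at an axis vertex). [cite: Kottwitz1986, §3] [cite: Serre1980Trees, Ch. II §1.1–1.2] -/
theorem map_endoGL_sub_one_latt_endoGL_le_scaleLattice_iff {c : K} (hc : c ≠ 0) (g₂ γ₂ : GL (Fin 2) K) (u : GL (Fin 1) K) :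
    (latt ((endoGL (g₂, (1 : GL (Fin 1) K)) : GL (Fin 3) K) : Matrix (Fin 3) (Fin 3) K)).map
        ((Matrix.toLin' (((endoGL (γ₂, u) : GL (Fin 3) K) : Matrix (Fin 3) (Fin 3) K) - 1)).restrictScalars 𝒪[K]) ≤
        scaleLattice c (latt ((endoGL (g₂, (1 : GL (Fin 1) K)) : GL (Fin 3) K) : Matrix (Fin 3) (Fin 3) K)) ↔
      (latt (g₂ : Matrix (Fin 2) (Fin 2) K)).map ((Matrix.toLin' ((γ₂ : Matrix (Fin 2) (Fin 2) K) - 1)).restrictScalars 𝒪[K]) ≤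
          scaleLattice c (latt (g₂ : Matrix (Fin 2) (Fin 2) K)) ∧
        Valued.v ((u : Matrix (Fin 1) (Fin 1) K) 0 0 - 1) ≤ Valued.v c := by
  rw [map_sub_one_latt_le_scaleLattice_iff hc, map_sub_one_latt_le_scaleLattice_iff hc, endoGL_inv_mul_endoGL_mul_endoGL,
    coe_endoGL_sub_one_eq_endoShape, forall_v_endoShape_le_iff]

/-- **THE SECOND-LAYER TOKEN `LEV₂`**: for `c ≠ 0`, `(ι(γ₂,u) − 1)²·latt ι(g₂,1) ⊆ c·latt ι(g₂,1) ⟺ (γ₂ − 1)²·latt g₂ ⊆ c·latt g₂ ∧ |(u − 1)²| ≤ |c|`.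
[cite: Kottwitz1986, §3] [cite: Serre1980Trees, Ch. II §1.1–1.2] -/
theorem map_endoGL_sub_one_sq_latt_endoGL_le_scaleLattice_iff {c : K} (hc : c ≠ 0) (g₂ γ₂ : GL (Fin 2) K) (u : GL (Fin 1) K) :
    (latt ((endoGL (g₂, (1 : GL (Fin 1) K)) : GL (Fin 3) K) : Matrix (Fin 3) (Fin 3) K)).map
        ((Matrix.toLin' ((((endoGL (γ₂, u) : GL (Fin 3) K) : Matrix (Fin 3) (Fin 3) K) - 1) ^ 2)).restrictScalars 𝒪[K]) ≤
        scaleLattice c (latt ((endoGL (g₂, (1 : GL (Fin 1) K)) : GL (Fin 3) K) : Matrix (Fin 3) (Fin 3) K)) ↔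
      (latt (g₂ : Matrix (Fin 2) (Fin 2) K)).map ((Matrix.toLin' (((γ₂ : Matrix (Fin 2) (Fin 2) K) - 1) ^ 2)).restrictScalars 𝒪[K]) ≤
          scaleLattice c (latt (g₂ : Matrix (Fin 2) (Fin 2) K)) ∧
        Valued.v (((u : Matrix (Fin 1) (Fin 1) K) 0 0 - 1) ^ 2) ≤ Valued.v c := by
  have hG : IsUnit ((((endoGL (g₂, (1 : GL (Fin 1) K)) : GL (Fin 3) K) : Matrix (Fin 3) (Fin 3) K)).det) := Matrix.isUnits_det_units _
  have hg : IsUnit ((g₂ : Matrix (Fin 2) (Fin 2) K)).det := Matrix.isUnits_det_units _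
  rw [map_toLin'_latt_le_scaleLattice_iff hc _ hG, map_toLin'_latt_le_scaleLattice_iff hc _ hg]
  -- conjugation commutes with squaring: `G⁻¹ (X − 1)² G = (G⁻¹ X G − 1)²` for invertible `G`
  have hsq : ∀ {n : ℕ} (G : GL (Fin n) K) (X : Matrix (Fin n) (Fin n) K),
      (G : Matrix (Fin n) (Fin n) K)⁻¹ * (X - 1) ^ 2 * (G : Matrix (Fin n) (Fin n) K) =
        ((G : Matrix (Fin n) (Fin n) K)⁻¹ * X * (G : Matrix (Fin n) (Fin n) K) - 1) ^ 2 := by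
    intro n G X
    have h1 : (G : Matrix (Fin n) (Fin n) K)⁻¹ * (G : Matrix (Fin n) (Fin n) K) = 1 := Matrix.nonsing_inv_mul _ (Matrix.isUnits_det_units G)
    have h2 : (G : Matrix (Fin n) (Fin n) K) * (G : Matrix (Fin n) (Fin n) K)⁻¹ = 1 := Matrix.mul_nonsing_inv _ (Matrix.isUnits_det_units G)
    set Gm := (G : Matrix (Fin n) (Fin n) K)
    set Gi := Gm⁻¹
    have e : Gi * X * Gm - 1 = Gi * (X - 1) * Gm := by rw [Matrix.mul_sub, Matrix.sub_mul, Matrix.mul_one, h1]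
    rw [e, pow_two, pow_two]
    calc Gi * ((X - 1) * (X - 1)) * Gm = Gi * (X - 1) * (Gm * Gi) * (X - 1) * Gm := by rw [h2]; noncomm_ring
      _ = Gi * (X - 1) * Gm * (Gi * (X - 1) * Gm) := by noncomm_ring
  have h3 := hsq (endoGL (g₂, (1 : GL (Fin 1) K))) (((endoGL (γ₂, u) : GL (Fin 3) K) : Matrix (Fin 3) (Fin 3) K))
  have h2 := hsq g₂ ((γ₂ : Matrix (Fin 2) (Fin 2) K))
  have hc3 : (endoGL (g₂, (1 : GL (Fin 1) K)) : GL (Fin 3) K).val⁻¹ * (endoGL (γ₂, u) : GL (Fin 3) K).val *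
      (endoGL (g₂, (1 : GL (Fin 1) K)) : GL (Fin 3) K).val =
      ((endoGL (g₂, (1 : GL (Fin 1) K)))⁻¹ * endoGL (γ₂, u) * endoGL (g₂, (1 : GL (Fin 1) K))).val := by
    rw [Units.val_mul, Units.val_mul, Matrix.coe_units_inv]
  have hc2 : (g₂ : Matrix (Fin 2) (Fin 2) K)⁻¹ * ((γ₂ : Matrix (Fin 2) (Fin 2) K)) * (g₂ : Matrix (Fin 2) (Fin 2) K) =
      (((g₂⁻¹ * γ₂ * g₂ : GL (Fin 2) K)) : Matrix (Fin 2) (Fin 2) K) := by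
    rw [Units.val_mul, Units.val_mul, Matrix.coe_units_inv]
  rw [h3, h2, hc3, hc2, endoGL_inv_mul_endoGL_mul_endoGL, coe_endoGL_sub_one_eq_endoShape, pow_two, pow_two, endoShape_mul_endoShape,
    forall_v_endoShape_le_iff]
  simp only [pow_two]

/-! ## §4 The vertex type of `latt g` is read on the Gram matrix of `g` itself -/

omit [Valued K ℤᵐ⁰] in
/-- `formCongr σ (g k) H = (σk)ᵀ · formCongr σ g H · k`. [cite: BruhatTits1972, §10] -/
private theorem formCongr_mul_right {N : ℕ} (σ : K →+* K) (g k : GL (Fin N) K) (H : Matrix (Fin N) (Fin N) K) :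
    formCongr σ (g * k) H = ((k : Matrix (Fin N) (Fin N) K).map σ)ᵀ * formCongr σ g H * (k : Matrix (Fin N) (Fin N) K) := by
  simp only [formCongr, Units.val_mul, Matrix.map_mul, Matrix.transpose_mul, Matrix.mul_assoc]

/-- **THE VERTEX TYPE IS BASIS-INDEPENDENT**: for `|σ·| = |·|` and `ϖ ≠ 0`, `latt g` is a vertex lattice of type `d` for `(σ, ϖ, H)` iff the Gram matrix `G = (σg)ᵀHg` of THIS basis is
integral with `ϖ·G⁻¹` integral and `|det G| = |ϖ|^d` (any other basis `g′` of `latt g` is `g·k` with `k ∈ GL_N(𝒪)`, and `(σk)ᵀGk` has the same three properties).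
[cite: BruhatTits1972, §10] [cite: Serre1980Trees, Ch. II §1.1] -/
theorem isVertexLattice_latt_iff_of_v {N : ℕ} (σ : K →+* K) (hvσ : ∀ a, Valued.v (σ a) = Valued.v a) {ϖ : K} (hϖ0 : ϖ ≠ 0) (H : Matrix (Fin N) (Fin N) K) (d : ℕ)
    (g : GL (Fin N) K) :
    IsVertexLattice σ ϖ H d (latt (g : Matrix (Fin N) (Fin N) K)) ↔
      IsIntMatrix (formCongr σ g H) ∧ IsIntMatrix (ϖ • (formCongr σ g H)⁻¹) ∧ Valued.v (formCongr σ g H).det = Valued.v ϖ ^ d := by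
  constructor
  · rintro ⟨g', hg', h1, h2, h3⟩
    -- `E := g'⁻¹ g ∈ GL_N(𝒪)`
    have hE : IsIntMatrix (((g'⁻¹ * g : GL (Fin N) K)) : Matrix (Fin N) (Fin N) K) := by
      rw [Units.val_mul, Matrix.coe_units_inv]; exact (latt_le_latt_iff (Matrix.isUnits_det_units g') _).1 hg'.le
    have hE' : IsIntMatrix ((((g'⁻¹ * g : GL (Fin N) K))⁻¹ : GL (Fin N) K) : Matrix (Fin N) (Fin N) K) := by
      rw [mul_inv_rev, inv_inv, Units.val_mul, Matrix.coe_units_inv]; exact (latt_le_latt_iff (Matrix.isUnits_det_units g) _).1 hg'.ge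
    set E : GL (Fin N) K := g'⁻¹ * g with hEdef
    have hgE : g = g' * E := by rw [hEdef, mul_inv_cancel_left]
    have hdetE : Valued.v (E : Matrix (Fin N) (Fin N) K).det = 1 := v_det_eq_one_of_isIntMatrix_inv hE hE'
    have hσE : IsIntMatrix ((E : Matrix (Fin N) (Fin N) K).map σ)ᵀ := isIntMatrix_transpose_map hvσ hE
    have hσE' : IsIntMatrix (((E⁻¹ : GL (Fin N) K) : Matrix (Fin N) (Fin N) K).map σ)ᵀ := isIntMatrix_transpose_map hvσ hE'
    set F' := formCongr σ g' H with hF'def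
    have hF : formCongr σ g H = ((E : Matrix (Fin N) (Fin N) K).map σ)ᵀ * F' * (E : Matrix (Fin N) (Fin N) K) := by rw [hgE, formCongr_mul_right]
    -- `F'` is invertible
    have hF'det : F'.det ≠ 0 := fun h0 => by
      rw [h0, map_zero] at h3; exact (pow_ne_zero d ((Valuation.ne_zero_iff _).2 hϖ0)) h3.symm
    have hF'u : IsUnit F'.det := isUnit_iff_ne_zero.2 hF'det
    -- the inverse of the new Gram matrix
    have hEE : ((E⁻¹ : GL (Fin N) K) : Matrix (Fin N) (Fin N) K) * (E : Matrix (Fin N) (Fin N) K) = 1 := by rw [← Units.val_mul, inv_mul_cancel, Units.val_one]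
    have hEE' : (E : Matrix (Fin N) (Fin N) K) * ((E⁻¹ : GL (Fin N) K) : Matrix (Fin N) (Fin N) K) = 1 := by rw [← Units.val_mul, mul_inv_cancel, Units.val_one]
    have hσEE : ((E : Matrix (Fin N) (Fin N) K).map σ)ᵀ * (((E⁻¹ : GL (Fin N) K) : Matrix (Fin N) (Fin N) K).map σ)ᵀ = 1 := by
      rw [← Matrix.transpose_mul, ← Matrix.map_mul, hEE, Matrix.map_one σ (map_zero σ) (map_one σ), Matrix.transpose_one]
    have hinv : (formCongr σ g H)⁻¹ = ((E⁻¹ : GL (Fin N) K) : Matrix (Fin N) (Fin N) K) * F'⁻¹ * (((E⁻¹ : GL (Fin N) K) : Matrix (Fin N) (Fin N) K).map σ)ᵀ := by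
      rw [hF]
      refine Matrix.inv_eq_right_inv ?_
      calc ((E : Matrix (Fin N) (Fin N) K).map σ)ᵀ * F' * (E : Matrix (Fin N) (Fin N) K) *
            (((E⁻¹ : GL (Fin N) K) : Matrix (Fin N) (Fin N) K) * F'⁻¹ * (((E⁻¹ : GL (Fin N) K) : Matrix (Fin N) (Fin N) K).map σ)ᵀ)
          = ((E : Matrix (Fin N) (Fin N) K).map σ)ᵀ * F' * ((E : Matrix (Fin N) (Fin N) K) * ((E⁻¹ : GL (Fin N) K) : Matrix (Fin N) (Fin N) K)) * F'⁻¹ *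
              (((E⁻¹ : GL (Fin N) K) : Matrix (Fin N) (Fin N) K).map σ)ᵀ := by noncomm_ring
        _ = 1 := by rw [hEE', Matrix.mul_one, Matrix.mul_assoc (((E : Matrix (Fin N) (Fin N) K).map σ)ᵀ), Matrix.mul_nonsing_inv _ hF'u, Matrix.mul_one, hσEE]
    refine ⟨?_, ?_, ?_⟩
    · rw [hF]; exact isIntMatrix_mul (isIntMatrix_mul hσE h1) hE
    · rw [hinv, ← Matrix.smul_mul, ← Matrix.mul_smul]; exact isIntMatrix_mul (isIntMatrix_mul hE' h2) hσE'
    · rw [hF, Matrix.det_mul, Matrix.det_mul, map_mul, map_mul, h3, hdetE, mul_one, Matrix.det_transpose, ← RingHom.mapMatrix_apply,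
        ← RingHom.map_det, hvσ, hdetE, one_mul]
  · intro h
    exact ⟨g, rfl, h⟩

/-! ## §5 Self-duality transport for a block form -/

omit [Valued K ℤᵐ⁰] in
/-- **THE GRAM MATRIX OF AN AXIS FRAME FOR A BLOCK FORM**: `formCongr σ ι(g₂, 1) (ι-shape(H₂, h)) = ι-shape((σg₂)ᵀH₂g₂, h)`. [cite: Jacobowitz1962, §4] [cite: Rogawski1990, §4.8 Case (a) p. 53] -/
theorem formCongr_endoGL_one_endoShape (σ : K →+* K) (g₂ : GL (Fin 2) K) (H₂ : Matrix (Fin 2) (Fin 2) K) (h : K) :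
    formCongr σ (endoGL (g₂, (1 : GL (Fin 1) K))) (!![H₂ 0 0, 0, H₂ 0 1; 0, h, 0; H₂ 1 0, 0, H₂ 1 1] : Matrix (Fin 3) (Fin 3) K) =
      !![(formCongr σ g₂ H₂) 0 0, 0, (formCongr σ g₂ H₂) 0 1; 0, h, 0; (formCongr σ g₂ H₂) 1 0, 0, (formCongr σ g₂ H₂) 1 1] := by
  simp only [formCongr, coe_endoGL_eq_endoShape, Units.val_one, Matrix.one_apply_eq]
  ext i j
  fin_cases i <;> fin_cases j <;>
    simp [Matrix.mul_apply, Fin.sum_univ_three, Fin.sum_univ_two, Matrix.transpose_apply, Matrix.map_apply, map_zero, map_one]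

omit [Valued K ℤᵐ⁰] in
/-- The determinant of an `ι`-shaped matrix is `det(block) · entry`. [cite: Rogawski1990, §4.8 Case (a) p. 53] -/
theorem det_endoShape (a : Matrix (Fin 2) (Fin 2) K) (b : K) :
    (!![a 0 0, 0, a 0 1; 0, b, 0; a 1 0, 0, a 1 1] : Matrix (Fin 3) (Fin 3) K).det = a.det * b := by
  rw [Matrix.det_fin_three, Matrix.det_fin_two]
  simp
  ring

omit [Valued K ℤᵐ⁰] in
/-- Scalars act blockwise on `ι`-shaped matrices. [cite: Rogawski1990, §4.8 Case (a) p. 53] -/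
theorem smul_endoShape (c : K) (a : Matrix (Fin 2) (Fin 2) K) (b : K) :
    c • (!![a 0 0, 0, a 0 1; 0, b, 0; a 1 0, 0, a 1 1] : Matrix (Fin 3) (Fin 3) K) = !![(c • a) 0 0, 0, (c • a) 0 1; 0, c * b, 0; (c • a) 1 0, 0, (c • a) 1 1] := by
  ext i j
  fin_cases i <;> fin_cases j <;> simp

omit [Valued K ℤᵐ⁰] in
/-- The inverse of an `ι`-shaped matrix with invertible blocks is `ι`-shaped with the inverse blocks. [cite: Rogawski1990, §4.8 Case (a) p. 53] -/
theorem inv_endoShape {a : Matrix (Fin 2) (Fin 2) K} (ha : IsUnit a.det) {b : K} (hb : b ≠ 0) :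
    (!![a 0 0, 0, a 0 1; 0, b, 0; a 1 0, 0, a 1 1] : Matrix (Fin 3) (Fin 3) K)⁻¹ = !![a⁻¹ 0 0, 0, a⁻¹ 0 1; 0, b⁻¹, 0; a⁻¹ 1 0, 0, a⁻¹ 1 1] := by
  refine Matrix.inv_eq_right_inv ?_
  rw [endoShape_mul_endoShape, Matrix.mul_nonsing_inv _ ha, mul_inv_cancel₀ hb]
  ext i j
  fin_cases i <;> fin_cases j <;> simp

/-- **SELF-DUALITY OF AN AXIS LATTICE IS SELF-DUALITY OF ITS W-BLOCK** for a block form `H = ι-shape(H₂, h)` with `|h| = 1` (`|σ·| = |·|`, `0 < |ϖ| ≤ 1`):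
`latt ι(g₂, 1)` is self-dual for `(σ, ϖ, H)` iff `latt g₂` is self-dual for `(σ, ϖ, H₂)`. [cite: BruhatTits1972, §10] [cite: Jacobowitz1962, §7] [cite: Kottwitz1986, §3] -/
theorem isSelfDualLattice_latt_endoGL_one_iff (σ : K →+* K) (hvσ : ∀ a, Valued.v (σ a) = Valued.v a) {ϖ : K} (hϖ0 : ϖ ≠ 0) (hϖ1 : Valued.v ϖ ≤ 1)
    (H₂ : Matrix (Fin 2) (Fin 2) K) {h : K} (hh : Valued.v h = 1) (g₂ : GL (Fin 2) K) :
    IsSelfDualLattice σ ϖ (!![H₂ 0 0, 0, H₂ 0 1; 0, h, 0; H₂ 1 0, 0, H₂ 1 1] : Matrix (Fin 3) (Fin 3) K)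
        (latt ((endoGL (g₂, (1 : GL (Fin 1) K)) : GL (Fin 3) K) : Matrix (Fin 3) (Fin 3) K)) ↔
      IsSelfDualLattice σ ϖ H₂ (latt (g₂ : Matrix (Fin 2) (Fin 2) K)) := by
  have hh0 : h ≠ 0 := fun h0 => by rw [h0, map_zero] at hh; exact zero_ne_one hh
  rw [IsSelfDualLattice, IsSelfDualLattice, isVertexLattice_latt_iff_of_v σ hvσ hϖ0, isVertexLattice_latt_iff_of_v σ hvσ hϖ0, formCongr_endoGL_one_endoShape,
    pow_zero, det_endoShape, map_mul, hh, mul_one]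
  set F := formCongr σ g₂ H₂ with hFdef
  by_cases hF : IsUnit F.det
  · rw [inv_endoShape hF hh0, smul_endoShape, IsIntMatrix, IsIntMatrix, forall_v_endoShape_le_iff, forall_v_endoShape_le_iff]
    have h1 : Valued.v h ≤ 1 := hh.le
    have h2 : Valued.v (ϖ * h⁻¹) ≤ 1 := by rw [map_mul, map_inv₀, hh, inv_one, mul_one]; exact hϖ1
    simp only [h1, h2, and_true]
    rfl
  · -- neither side has a unimodular Gram matrix
    have hdet : Valued.v F.det ≠ 1 := fun h1 => hF (isUnit_iff_ne_zero.2 fun h0 => by rw [h0, map_zero] at h1; exact zero_ne_one h1)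
    constructor
    · rintro ⟨-, -, h3⟩; exact (hdet h3).elim
    · rintro ⟨-, -, h3⟩; exact (hdet h3).elim

end Literature.NumberTheory.Automorphic.UnitaryLatticeTree
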